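import Mathlib.Geometry.Manifold.SmoothEmbedding
import Mathlib.Geometry.Manifold.Instances.Real
import Mathlib.Geometry.Manifold.Instances.Sphere
import Mathlib.Geometry.Manifold.Diffeomorph
import Mathlib.Geometry.Manifold.IsManifold.InteriorBoundary
import Mathlib.Geometry.Manifold.MFDeriv.Basic
import Mathlib.Geometry.Manifold.VectorBundle.Riemannian
import Mathlib.Geometry.Manifold.VectorBundle.Tangent
import Literature.Geometry.Lorentzian.PseudoRiemannianMetric
import Literature.Geometry.Lorentzian.LeviCivita
import Literature.Geometry.Lorentzian.Geodesic
import Literature.Geometry.Riemannian.IsotropicCurvature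
import HarnessLib

/-!
# Graham–Guillarmou–Stefanov–Uhlmann: on a simple asymptotically hyperbolic manifold the
exponential map extends to the compactification as a diffeomorphism — corollary: the conformal
boundary is a standard sphere (Ann. Inst. Fourier 69 (2019), Prop. 5.13; named fact)

Topic `Literature/Geometry/Riemannian`. Vendored for route `SmoothPoincare4/EinsteinBulk`: grounds
(as the printed half of) the recognisers
`Summit.SmoothPoincare4.SmoothPoincare4.Theses.EinsteinBulk.EinsteinHadamardFillingStandard`
(stmt-SmoothPoincare4-7999) and `….HadamardFillingStandard` (stmt-SmoothPoincare4-8000), and is the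
"visual boundary" lemma of the cards `einstein-bulk-irons-boundary` / `information-metric-hadamard`.

Source read (held: arXiv:1709.05053 = C. R. Graham, C. Guillarmou, P. Stefanov, G. Uhlmann,
*X-ray transform and boundary rigidity for asymptotically hyperbolic manifolds*, Ann. Inst.
Fourier 69 (2019) 2857–2919, doi:10.5802/aif.3339), verbatim:

* PDF p. 3 (setting): "Let `M̄` be a compact connected smooth manifold-with-boundary of dimension
  `n+1` with `n ≥ 1`. A smooth metric `g` on the interior `M` of `M̄` is said to be asymptotically
  hyperbolic if `ḡ₀ := ρ₀² g` extends to a smooth metric on `M̄` with `|dρ₀|_{ḡ₀} = 1` at `∂M̄`,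
  where `ρ₀ ∈ C^∞(M̄; ℝ_{≥0})` is a smooth defining function for `∂M̄`, i.e. `{ρ₀ = 0} = ∂M̄` with
  `dρ₀` not vanishing at `∂M̄`."
* PDF p. 10: "We say that `(M, g)` is non-trapping if `K = ∅`" (`K = Γ₋ ∩ Γ₊` the trapped set of
  the geodesic flow; Lemma 2.4: "`(M,g)` is non-trapping if and only if `Γ₊ = ∅` if and only if
  `Γ₋ = ∅`", `Γ∓` = the points of `S*M` whose trajectory does not tend to `∂M̄` as
  `t → ±∞`); "Observe that if `(M, g)` is non-trapping, then `M` is necessarily simply connected,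
  as otherwise there would be a closed geodesic, and `g` would have a non-empty trapped set."
* PDF p. 27, **Definition 5.3.** "A non-trapping asymptotically hyperbolic manifold `(M, g)` is
  said to be simple if `E_s(z) ∩ E_u(z) = {0}` for each `z ∈ S*M`." followed by: "A non-trapping
  asymptotically hyperbolic manifold with non-positive curvature is simple."
* PDF p. 28, **Proposition 5.11.** "Let `(M, g)` be a simple asymptotically hyperbolic manifold.
  If `p, q ∈ M̄`, `p ≠ q`, there is a unique geodesic (viewed as an unparametrized curve)
  connecting `p` and `q`."
* PDF p. 30, **Proposition 5.13.** "If `(M, g)` is simple, then the following map is a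
  diffeomorphism `Ψ : 𝒯⁺S̄*M → M̄ × M̄ ∖ diag`, `Ψ(τ, z) = (π(z), π(φ̄_τ(z)))`", where (p. 30)
  `𝒯⁺S̄*M = {(τ, z) ∈ ℝ × S̄*M : 0 < τ ≤ τ₊(z)}`, `φ̄_τ` is the rescaled geodesic flow extended
  smoothly to the compactified unit cosphere bundle `S̄*M` and `τ₊(z)` the exit time (§5.1); p. 5:
  "the exponential map extends smoothly to the boundary as a diffeomorphism in an appropriate
  sense (Propositions 5.11 and 5.13)".

## The corollary vendored (`ggsu_boundary_sphere_of_nonTrapping_of_nonpos`) and its derivation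

COROLLARY (of Prop. 5.13 with the remark after Def. 5.3): *if `(M, g)` is a non-trapping
asymptotically hyperbolic manifold (smooth compactification `M̄`, `dim M̄ = n + 1`, `n ≥ 1`) with
non-positive sectional curvature, then `∂M̄` is diffeomorphic to the sphere `Sⁿ`.* Derivation: by
the remark `(M, g)` is simple; fix `p ∈ M`. `Ψ` is a diffeomorphism of manifolds with corners, and
`Ψ⁻¹({p} × M̄) = {(τ, z) : z ∈ S*_pM, 0 < τ ≤ τ₊(z)}`; its boundary face `{τ = τ₊(z)}` — the graph of
the smooth positive function `τ₊` over the fibre `S*_pM ≅ Sⁿ` — is carried by `Ψ` onto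
`{p} × ∂M̄` (interior points `π(φ̄_τ(z))`, `τ < τ₊(z)`, lie in `M`; `π(φ̄_{τ₊(z)}(z)) ∈ ∂M̄`), and a
diffeomorphism of manifolds with boundary restricts to a diffeomorphism of the boundaries. Hence
the endpoint map `S*_pM → ∂M̄`, `z ↦ π(φ̄_{τ₊(z)}(z))`, is a diffeomorphism `Sⁿ ≅ ∂M̄`. Nothing beyond
this restriction is claimed; in particular the corollary is WEAKER than Prop. 5.13.

## Rendering

* `N` (the paper's interior `M`): a connected Hausdorff second-countable `C^∞` manifold without
  boundary modelled on `ℝⁿ⁺¹` (`𝓡 (n+1)`), with a `C^∞` Riemannian metric `g` on `TN`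
  (`Bundle.ContMDiffRiemannianMetric`) carrying its Levi-Civita connection
  (`[(ofRiemannian g).HasLeviCivita]`, `LeviCivita.lean`).
* ASYMPTOTICALLY HYPERBOLIC WITH SMOOTH COMPACTIFICATION (p. 3), as an eight-conjunct package in
  the shape of `Literature.Geometry.Riemannian.IsConformallyCompactFillingOfDim`
  (`ConformallyCompactFilling.lean`) but with a `C^∞` (not `C²`) compactified metric `ḡ` and no
  boundary representative: a compact connected `C^∞` manifold with boundary `X̄` (`𝓡∂ (n+1)`), a
  smooth embedding `j : N → X̄` onto the interior, a closed `n`-manifold `B` (the paper's `∂M̄`) with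
  a smooth embedding `ι : B → X̄` onto the boundary, a smooth `ρ ≥ 0` on `X̄` vanishing exactly on
  the boundary whose `ḡ`-gradient is a unit vector along the boundary (`|dρ|_ḡ = 1`, which also
  gives `dρ ≠ 0` there), and `j^*ḡ = (ρ ∘ j)² g`.
* NON-TRAPPING (p. 10, `K = ∅` ⇔ `Γ₊ = ∅`, Lemma 2.4): every non-constant geodesic
  `γ : ℝ → N` of the Levi-Civita connection (`IsGeodesic`, `Geodesic.lean`; AH metrics are
  complete, so all geodesics are entire) eventually leaves every compact subset of `N` as
  `t → +∞` (time reversal of a geodesic is a geodesic, so this is `Γ₊ = Γ₋ = ∅`).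
* NON-POSITIVE CURVATURE: `Rm(X, Y, Y, X) ≤ 0` for `g`-orthonormal `X, Y` (`curvatureForm` of
  `IsotropicCurvature.lean`, `= K(X ∧ Y)` on orthonormal pairs, Lee's sign).
* CONCLUSION: `B` is diffeomorphic to the unit sphere `Sⁿ ⊂ ℝⁿ⁺¹` (`Nonempty (B ≃ₘ Sⁿ)`).

What the route items need beyond this fact (recorded, not claimed): (a) their compactification is
only `C²` (`IsConformallyCompactFilling`), whereas Prop. 5.13 is printed for SMOOTH AH metrics —
for Einstein bulks with `4`-dimensional boundary Chruściel–Delay–Lee–Skinner 2005 give `C^{3,α}`,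
polyhomogeneous (`x⁴ log x`) compactifications, not `C^∞` in general; (b) non-trapping is not a
hypothesis there and must come from `K ≤ 0` plus simple connectivity of the bulk (Cartan–Hadamard:
geodesics of a Hadamard manifold are minimising lines, hence proper). NOT vendored: Prop. 5.13
itself (`S̄*M`, `φ̄_τ`, `τ₊` are not in the tree), Def. 5.3 (stable/unstable bundles), Prop. 5.11,
the p. 10 remark "non-trapping ⇒ simply connected".

## References

* [GrahamEtAl2020] C. R. Graham, C. Guillarmou, P. Stefanov, G. Uhlmann, Ann. Inst. Fourier 69
  (2019) 2857–2919, doi:10.5802/aif.3339 (arXiv:1709.05053: p. 3, p. 10 with Lemma 2.4, Def. 5.3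
  and the remark after it (p. 27), Prop. 5.11 (p. 28), Prop. 5.13 (p. 30)).
* P. Eberlein, B. O'Neill, *Visibility manifolds*, Pacific J. Math. 46 (1973) (the ideal boundary
  of a Hadamard manifold; background for Prop. 5.11).
-/

noncomputable section

open Bundle Set
open scoped Manifold ContDiff

namespace Literature.Geometry.Riemannian

open Literature.Geometry.Lorentzian (PseudoRiemannianMetric IsGeodesic velocity)
open Literature.Geometry.Lorentzian.PseudoRiemannianMetric

/-- **Graham–Guillarmou–Stefanov–Uhlmann (Ann. Inst. Fourier 69, 2019), corollary of Prop. 5.13** (named fact, D-0014;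
Prop. 5.13: "If `(M, g)` is simple, then `Ψ : 𝒯⁺S̄*M → M̄ × M̄ ∖ diag`,
`Ψ(τ, z) = (π(z), π(φ̄_τ(z)))` is a diffeomorphism"; remark after Def. 5.3: "A non-trapping
asymptotically hyperbolic manifold with non-positive curvature is simple"; restricting `Ψ` to the
exit face over a fixed base point `p` identifies the unit sphere `S*_pM ≅ Sⁿ` with `∂M̄`, see the
module docstring). VENDORED CONSEQUENCE: for `n ≥ 1`, every connected smooth `(n+1)`-manifold `N`
with a smooth Riemannian metric `g` which (i) is ASYMPTOTICALLY HYPERBOLIC WITH SMOOTH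
COMPACTIFICATION — there are a compact connected smooth manifold with boundary `X̄`, a smooth
embedding `j : N ≅ int X̄`, a closed smooth `n`-manifold `B` with a smooth embedding `ι : B ≅ ∂X̄`,
a smooth defining function `ρ ≥ 0` (`ρ = 0` exactly on `∂X̄`, `|dρ|_ḡ = 1` there) and a SMOOTH
metric `ḡ` on `X̄` with `j^*ḡ = ρ² g` (GGSU p. 3) —, (ii) is NON-TRAPPING — every non-constant
geodesic of `g` eventually leaves every compact subset of `N` (p. 10, `Γ₊ = ∅`) — and (iii) has
NON-POSITIVE SECTIONAL CURVATURE (`Rm(X,Y,Y,X) ≤ 0` on orthonormal pairs), has boundary at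
infinity `B` DIFFEOMORPHIC TO THE SPHERE `Sⁿ`. Weaker than the printed proposition; grounds the
printed half of `Summit.SmoothPoincare4.SmoothPoincare4.Theses.EinsteinBulk.EinsteinHadamardFillingStandard`
/ `….HadamardFillingStandard` (which are STRONGER: `C²` compactification, non-trapping not assumed).
[cite: GrahamEtAl2020, Prop. 5.13 (p. 30), Def. 5.3 and remark (p. 27), p. 3, p. 10] -/
def ggsu_boundary_sphere_of_nonTrapping_of_nonpos : Prop :=
  ∀ (n : ℕ), 1 ≤ n →
    ∀ (B : Type) [TopologicalSpace B] [T2Space B] [SecondCountableTopology B]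
      [ChartedSpace (EuclideanSpace ℝ (Fin n)) B] [IsManifold (𝓡 n) ∞ B] [CompactSpace B]
      (N : Type) [TopologicalSpace N] [T2Space N] [SecondCountableTopology N] [ConnectedSpace N]
      [ChartedSpace (EuclideanSpace ℝ (Fin (n + 1))) N] [IsManifold (𝓡 (n + 1)) ∞ N]
      (g : Bundle.ContMDiffRiemannianMetric (𝓡 (n + 1)) ∞ (EuclideanSpace ℝ (Fin (n + 1)))
        (TangentSpace (𝓡 (n + 1)) : N → Type _))
      [(PseudoRiemannianMetric.ofRiemannian g).HasLeviCivita],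
      -- (i) asymptotically hyperbolic, smooth compactification (GGSU p. 3)
      (∃ (X : Type) (_ : TopologicalSpace X) (_ : T2Space X) (_ : SecondCountableTopology X)
          (_ : ChartedSpace (EuclideanHalfSpace (n + 1)) X) (_ : IsManifold (𝓡∂ (n + 1)) ∞ X)
          (_ : CompactSpace X) (_ : ConnectedSpace X) (j : N → X) (ι : B → X) (ρ : X → ℝ)
          (gb : Bundle.ContMDiffRiemannianMetric (𝓡∂ (n + 1)) ∞ (EuclideanSpace ℝ (Fin (n + 1)))
            (TangentSpace (𝓡∂ (n + 1)) : X → Type _)),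
          Manifold.IsSmoothEmbedding (𝓡 (n + 1)) (𝓡∂ (n + 1)) ∞ j ∧
          Set.range j = (𝓡∂ (n + 1)).interior X ∧
          Manifold.IsSmoothEmbedding (𝓡 n) (𝓡∂ (n + 1)) ∞ ι ∧
          Set.range ι = (𝓡∂ (n + 1)).boundary X ∧
          ContMDiff (𝓡∂ (n + 1)) 𝓘(ℝ, ℝ) ∞ ρ ∧ (∀ x : X, 0 ≤ ρ x) ∧
          (∀ x : X, ρ x = 0 ↔ x ∈ (𝓡∂ (n + 1)).boundary X) ∧
          (∀ y : B, ∃ ν : TangentSpace (𝓡∂ (n + 1)) (ι y), gb.inner (ι y) ν ν = 1 ∧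
            ∀ v : TangentSpace (𝓡∂ (n + 1)) (ι y),
              gb.inner (ι y) ν v = mfderiv (𝓡∂ (n + 1)) 𝓘(ℝ, ℝ) ρ (ι y) v) ∧
          (∀ (x : N) (v w : TangentSpace (𝓡 (n + 1)) x),
            gb.inner (j x) (mfderiv (𝓡 (n + 1)) (𝓡∂ (n + 1)) j x v)
              (mfderiv (𝓡 (n + 1)) (𝓡∂ (n + 1)) j x w) = ρ (j x) ^ 2 * g.inner x v w)) →
      -- (ii) non-trapping (GGSU p. 10)
      (∀ γ : ℝ → N, IsGeodesic (PseudoRiemannianMetric.ofRiemannian g).leviCivita γ →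
          velocity (𝓡 (n + 1)) γ 0 ≠ 0 →
          ∀ K : Set N, IsCompact K → ∃ T : ℝ, ∀ t : ℝ, T ≤ t → γ t ∉ K) →
      -- (iii) non-positive sectional curvature
      (∀ (x : N) (X Y : TangentSpace (𝓡 (n + 1)) x), g.inner x X X = 1 → g.inner x Y Y = 1 →
          g.inner x X Y = 0 →
          (PseudoRiemannianMetric.ofRiemannian g).curvatureForm
            (PseudoRiemannianMetric.ofRiemannian g).leviCivita x X Y Y X ≤ 0) →
      Nonempty (B ≃ₘ⟮𝓡 n, 𝓡 n⟯ Metric.sphere (0 : EuclideanSpace ℝ (Fin (n + 1))) 1)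

end Literature.Geometry.Riemannian

end
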